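import Literature.NumberTheory.Rogawski1990.EndoscopicTorusRankTwo      -- ★ `torusMatrix` (the compact torus `T_c = {P diag(u₁,u₂) P⁻¹}` of `U(Φ₂)`)
import Mathlib.Analysis.Complex.Basic
import Mathlib.Analysis.SpecialFunctions.Pow.Real
import HarnessLib

/-!
# Elliptic orbits in `U(1,1)`: the Hilbert–Schmidt norm along `y ↦ y γ y⁻¹` is an exact quadratic function of `‖y‖_HS`
# (the rank-one identity `‖y γ y⁻¹ − λ₂·1‖_HS = |λ₁ − λ₂| ‖y‖²_HS ∕ 2`; orbit HS-balls lie in group HS-balls of radius `≍ √R`)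

Topic `NumberTheory/Rogawski1990`; namespace `Literature.NumberTheory.Rogawski1990`.  THEOREMS ONLY (no `def`, no instance, no notation, no axiom, no named fact,
no `sorry`).  Cell `pub/hodgecm-mathlib`, crux H413 (`stmt-HodgeConjecture-24833`), F0∕P3c line LH3, sub-organ (VOL-ell-id) of the residual (VOL) behind DEAL #5 (CONV)
(LH3-plan (g0) START word 2026-09-02T03:07:21Z; seat LH3-p04 (g0)).

THE MATHEMATICS (pure `2 × 2` matrix algebra over `ℂ`, form `Φ₂ = antidiag(1,1)` spelled as in the tree).  Let `y ∈ M₂(ℂ)` be `Φ₂`-unitary, `ȳᵀ Φ₂ y = Φ₂` (the membership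
condition of ★ `unitaryGroupOfForm (starRingEnd ℂ) Φ₂` = ★ `archLocal L 2 Φ₂ w`), and let `γ = torusMatrix λ₁ λ₂ = P diag(λ₁, λ₂) P⁻¹` be a point of the compact torus
(★ `torusMatrix`; every regular elliptic element of `U(1,1)` is conjugate to one).  Then
* `y⁻¹ = (d̄ b̄; c̄ ā)` for `y = (a b; c d)` (`archPlane_inv_eq`), with the unitarity relations `āc + c̄a = 0`, `ād + c̄b = 1`, `ab̄ + bā = 0`, `cd̄ + dc̄ = 0`, …;
* **rank one**: `y γ y⁻¹ − λ₂·1 = ((λ₁−λ₂)∕2) · u (Φ₂ ū)ᵀ` with `u = y·(1,1)ᵀ = (a+b, c+d)` (`conj_torusMatrix_sub_smul_one_eq`), and `|a+b|² + |c+d|² = ‖y‖²_HS`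
  (`normSq_rowSum_eq_hs`);
* **THE IDENTITY** `Σ_{ij} |(y γ y⁻¹ − λ₂·1)_{ij}|² = (|λ₁−λ₂|∕2)² (Σ_{ij} |y_{ij}|²)²` (`hs_conj_torusMatrix_sub_smul_one`);
* **ORBIT BALLS ⊆ GROUP BALLS**: if `Σ|(yγy⁻¹)_{ij}|² ≤ R` and `λ₁ ≠ λ₂` then `Σ|y_{ij}|² ≤ 2 √(2R + 4|λ₂|²) ∕ |λ₁−λ₂|` (`hs_le_of_hs_conj_torusMatrix_le`) — the input that
  reduces Harish-Chandra's volume growth of a regular elliptic orbit in the HS weight to the linear growth of Haar volume of HS-balls in `U(1,1)` itself.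
[BeuzartPlessis2020Asterisque, §1.5 (1.5.2)–(1.5.3) p. 31] uses such polynomial comparisons between `σ(yγy⁻¹)` and `σ(y)`; here the rank-one structure of
`γ − λ₂·1` for `2 × 2` tori makes it an identity.
HONEST LABEL: HC_CM is proved only modulo the 7 printed citations (2 remaining: hLiu418 = stmt-HodgeConjecture-24832, h413 = stmt-HodgeConjecture-24833) until rung 0
closes; this file closes no organ — it is one brick of (VOL), itself the residual of (CONV), itself A3-hardening of the LETTERS O1∕O3 of `stub_N9`.

## References
* [BeuzartPlessis2020Asterisque] R. Beuzart-Plessis, *A local trace formula for the Gan–Gross–Prasad conjecture for unitary groups: the archimedean case*,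
  Astérisque 418 (2020), §1.5 p. 31.
* [Rogawski1990] J. D. Rogawski, *Automorphic Representations of Unitary Groups in Three Variables*, Ann. of Math. Stud. 123 (1990), §4.6 Prop. 4.6.1 (the torus
  `T_c ⊂ U(Φ₂)`), §3.1 p. 19.
-/

set_option autoImplicit false

noncomputable section

open scoped Matrix ComplexConjugate

namespace Literature.NumberTheory.Rogawski1990

section EllipticOrbit

variable {y : Matrix (Fin 2) (Fin 2) ℂ}
  (hy : (y.map (starRingEnd ℂ))ᵀ * (Matrix.of fun i j : Fin 2 => if i.val + j.val + 1 = 2 then (1 : ℂ) else 0) * y =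
    (Matrix.of fun i j : Fin 2 => if i.val + j.val + 1 = 2 then (1 : ℂ) else 0))

include hy

/-- The four entries of `ȳᵀ Φ₂ y = Φ₂` for `y = (a b; c d)`: `āc + c̄a = 0`, `ād + c̄b = 1`, `b̄c + d̄a = 1`, `b̄d + d̄b = 0`. [cite: Rogawski1990, §3.1 p. 19] -/
theorem archPlane_unitarity_relations :
    conj (y 0 0) * y 1 0 + conj (y 1 0) * y 0 0 = 0 ∧ conj (y 0 0) * y 1 1 + conj (y 1 0) * y 0 1 = 1 ∧
      conj (y 0 1) * y 1 0 + conj (y 1 1) * y 0 0 = 1 ∧ conj (y 0 1) * y 1 1 + conj (y 1 1) * y 0 1 = 0 := by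
  have h00 := congrFun (congrFun hy 0) 0
  have h01 := congrFun (congrFun hy 0) 1
  have h10 := congrFun (congrFun hy 1) 0
  have h11 := congrFun (congrFun hy 1) 1
  simp [Matrix.mul_apply, Fin.sum_univ_two, Matrix.of_apply, Matrix.transpose_apply, Matrix.map_apply] at h00 h01 h10 h11
  refine ⟨?_, ?_, ?_, ?_⟩
  · linear_combination h00
  · linear_combination h01
  · linear_combination h10
  · linear_combination h11

/-- `(d̄ b̄; c̄ ā) · y = 1` for a `Φ₂`-unitary `y = (a b; c d)` (the matrix `Φ₂ ȳᵀ Φ₂` is a left inverse). [cite: Rogawski1990, §3.1 p. 19] -/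
theorem archPlane_conjAdj_mul_eq_one : !![conj (y 1 1), conj (y 0 1); conj (y 1 0), conj (y 0 0)] * y = 1 := by
  obtain ⟨h00, h01, h10, h11⟩ := archPlane_unitarity_relations hy
  ext i j
  fin_cases i <;> fin_cases j <;>
    simp [Matrix.mul_apply, Fin.sum_univ_two]
  · linear_combination h10
  · linear_combination h11
  · linear_combination h00
  · linear_combination h01

/-- **The inverse of a `Φ₂`-unitary matrix**: `y⁻¹ = Φ₂ ȳᵀ Φ₂ = (d̄ b̄; c̄ ā)` for `y = (a b; c d)`. [cite: Rogawski1990, §3.1 p. 19] -/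
theorem archPlane_inv_eq : y⁻¹ = !![conj (y 1 1), conj (y 0 1); conj (y 1 0), conj (y 0 0)] :=
  Matrix.inv_eq_left_inv (archPlane_conjAdj_mul_eq_one hy)

/-- `y · (d̄ b̄; c̄ ā) = 1` (a left inverse of a square matrix is a right inverse). [cite: Rogawski1990, §3.1 p. 19] -/
theorem archPlane_mul_conjAdj_eq_one : y * !![conj (y 1 1), conj (y 0 1); conj (y 1 0), conj (y 0 0)] = 1 :=
  mul_eq_one_comm.mp (archPlane_conjAdj_mul_eq_one hy)

/-- The relations of `y Φ₂ ȳᵀ = Φ₂`: `ad̄ + bc̄ = 1`, `ab̄ + bā = 0`, `cd̄ + dc̄ = 0`, `cb̄ + dā = 1`. [cite: Rogawski1990, §3.1 p. 19] -/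
theorem archPlane_unitarity_relations' :
    y 0 0 * conj (y 1 1) + y 0 1 * conj (y 1 0) = 1 ∧ y 0 0 * conj (y 0 1) + y 0 1 * conj (y 0 0) = 0 ∧
      y 1 0 * conj (y 1 1) + y 1 1 * conj (y 1 0) = 0 ∧ y 1 0 * conj (y 0 1) + y 1 1 * conj (y 0 0) = 1 := by
  have h := archPlane_mul_conjAdj_eq_one hy
  have h00 := congrFun (congrFun h 0) 0
  have h01 := congrFun (congrFun h 0) 1
  have h10 := congrFun (congrFun h 1) 0
  have h11 := congrFun (congrFun h 1) 1
  simp [Matrix.mul_apply, Fin.sum_univ_two] at h00 h01 h10 h11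
  refine ⟨?_, ?_, ?_, ?_⟩
  · linear_combination h00
  · linear_combination h01
  · linear_combination h10
  · linear_combination h11

/-- **RANK ONE**: `y γ y⁻¹ − λ₂·1 = ((λ₁ − λ₂)∕2) · (u_i ū_{1−j})_{ij}` with `u = (a+b, c+d) = y·(1,1)ᵀ`, for `γ = torusMatrix λ₁ λ₂`
(`torusMatrix λ₁ λ₂ − λ₂·1 = ((λ₁−λ₂)∕2)·(1 1; 1 1)` is rank one). [cite: Rogawski1990, §4.6 Prop. 4.6.1] -/
theorem conj_torusMatrix_sub_smul_one_eq (l₁ l₂ : ℂ) :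
    y * torusMatrix l₁ l₂ * y⁻¹ - l₂ • (1 : Matrix (Fin 2) (Fin 2) ℂ) =
      ((l₁ - l₂) / 2) • !![(y 0 0 + y 0 1) * conj (y 1 0 + y 1 1), (y 0 0 + y 0 1) * conj (y 0 0 + y 0 1);
                            (y 1 0 + y 1 1) * conj (y 1 0 + y 1 1), (y 1 0 + y 1 1) * conj (y 0 0 + y 0 1)] := by
  obtain ⟨h1, h2, h3, h4⟩ := archPlane_unitarity_relations' hy
  rw [archPlane_inv_eq hy]
  ext i j
  fin_cases i <;> fin_cases j <;>
    simp [Matrix.mul_apply, Fin.sum_univ_two, torusMatrix, map_add]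
  · linear_combination l₂ * h1
  · linear_combination l₂ * h2
  · linear_combination l₂ * h3
  · linear_combination l₂ * h4

/-- `|a + b|² + |c + d|² = |a|² + |b|² + |c|² + |d|²` for a `Φ₂`-unitary `(a b; c d)` (the cross terms `2 Re(a b̄)`, `2 Re(c d̄)` vanish by `ab̄ + bā = 0`, `cd̄ + dc̄ = 0`):
`‖y·(1,1)ᵀ‖² = ‖y‖²_HS`. [cite: Rogawski1990, §3.1 p. 19] -/
theorem normSq_rowSum_eq_hs :
    ‖y 0 0 + y 0 1‖ ^ 2 + ‖y 1 0 + y 1 1‖ ^ 2 = ‖y 0 0‖ ^ 2 + ‖y 0 1‖ ^ 2 + ‖y 1 0‖ ^ 2 + ‖y 1 1‖ ^ 2 := by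
  obtain ⟨-, h2, h3, -⟩ := archPlane_unitarity_relations' hy
  have hre1 : (y 0 0 * conj (y 0 1)).re = 0 := by
    have e := congrArg Complex.re h2
    have hc : (y 0 1 * conj (y 0 0)).re = (y 0 0 * conj (y 0 1)).re := by
      rw [← Complex.conj_re (y 0 0 * conj (y 0 1)), map_mul, Complex.conj_conj, mul_comm]
    simp only [Complex.add_re, Complex.zero_re, hc] at e
    linarith
  have hre2 : (y 1 0 * conj (y 1 1)).re = 0 := by
    have e := congrArg Complex.re h3
    have hc : (y 1 1 * conj (y 1 0)).re = (y 1 0 * conj (y 1 1)).re := by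
      rw [← Complex.conj_re (y 1 0 * conj (y 1 1)), map_mul, Complex.conj_conj, mul_comm]
    simp only [Complex.add_re, Complex.zero_re, hc] at e
    linarith
  simp only [Complex.sq_norm, Complex.normSq_add, hre1, hre2]
  ring

/-- **THE IDENTITY** `Σ_{ij} |(y γ y⁻¹ − λ₂·1)_{ij}|² = (|λ₁ − λ₂| ∕ 2)² · (Σ_{ij} |y_{ij}|²)²` for `Φ₂`-unitary `y` and `γ = torusMatrix λ₁ λ₂`: along a regular elliptic orbit
the recentered Hilbert–Schmidt norm is an exact quadratic function of `‖y‖_HS`. [cite: BeuzartPlessis2020Asterisque, §1.5 p. 31] [cite: Rogawski1990, §4.6 Prop. 4.6.1] -/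
theorem hs_conj_torusMatrix_sub_smul_one (l₁ l₂ : ℂ) :
    ∑ i : Fin 2, ∑ j : Fin 2, ‖(y * torusMatrix l₁ l₂ * y⁻¹ - l₂ • (1 : Matrix (Fin 2) (Fin 2) ℂ)) i j‖ ^ 2 =
      (‖l₁ - l₂‖ / 2) ^ 2 * (∑ i : Fin 2, ∑ j : Fin 2, ‖y i j‖ ^ 2) ^ 2 := by
  rw [conj_torusMatrix_sub_smul_one_eq hy]
  have hs : ∑ i : Fin 2, ∑ j : Fin 2, ‖y i j‖ ^ 2 = ‖y 0 0 + y 0 1‖ ^ 2 + ‖y 1 0 + y 1 1‖ ^ 2 := by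
    rw [normSq_rowSum_eq_hs hy]
    simp only [Fin.sum_univ_two]
    ring
  rw [hs]
  simp only [Fin.sum_univ_two, Matrix.smul_apply, Matrix.of_apply, Matrix.cons_val', Matrix.cons_val_zero, Matrix.cons_val_one,
    Matrix.empty_val', Matrix.cons_val_fin_one, smul_eq_mul, norm_mul, norm_div, Complex.norm_conj, Complex.norm_two]
  ring

/-- **ORBIT HS-BALLS LIE IN GROUP HS-BALLS OF RADIUS `≍ √R`**: if `Σ|(y γ y⁻¹)_{ij}|² ≤ R` for `γ = torusMatrix λ₁ λ₂` with `λ₁ ≠ λ₂` (regular), then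
`Σ|y_{ij}|² ≤ 2 √(2R + 4|λ₂|²) ∕ |λ₁ − λ₂|` (entrywise `|p − q|² ≤ 2|p|² + 2|q|²`, then the identity). [cite: BeuzartPlessis2020Asterisque, §1.5 (1.5.2)–(1.5.3) p. 31] -/
theorem hs_le_of_hs_conj_torusMatrix_le {l₁ l₂ : ℂ} (hne : l₁ ≠ l₂) {R : ℝ}
    (hR : ∑ i : Fin 2, ∑ j : Fin 2, ‖(y * torusMatrix l₁ l₂ * y⁻¹) i j‖ ^ 2 ≤ R) :
    ∑ i : Fin 2, ∑ j : Fin 2, ‖y i j‖ ^ 2 ≤ 2 * Real.sqrt (2 * R + 4 * ‖l₂‖ ^ 2) / ‖l₁ - l₂‖ := by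
  set S : ℝ := ∑ i : Fin 2, ∑ j : Fin 2, ‖y i j‖ ^ 2 with hSdef
  have hS0 : 0 ≤ S := Finset.sum_nonneg fun i _ => Finset.sum_nonneg fun j _ => by positivity
  have hl : 0 < ‖l₁ - l₂‖ := norm_pos_iff.mpr (sub_ne_zero.mpr hne)
  -- entrywise `|p - q|² ≤ 2|p|² + 2|q|²`
  have hpq : ∀ p q : ℂ, ‖p - q‖ ^ 2 ≤ 2 * ‖p‖ ^ 2 + 2 * ‖q‖ ^ 2 := by
    intro p q
    have h1 : ‖p - q‖ ≤ ‖p‖ + ‖q‖ := norm_sub_le p q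
    have h2 : 0 ≤ ‖p - q‖ := norm_nonneg _
    nlinarith [sq_nonneg (‖p‖ - ‖q‖), norm_nonneg p, norm_nonneg q]
  have hM : ∑ i : Fin 2, ∑ j : Fin 2, ‖(y * torusMatrix l₁ l₂ * y⁻¹ - l₂ • (1 : Matrix (Fin 2) (Fin 2) ℂ)) i j‖ ^ 2 ≤
      2 * R + 4 * ‖l₂‖ ^ 2 := by
    have hsum : ∑ i : Fin 2, ∑ j : Fin 2, ‖(y * torusMatrix l₁ l₂ * y⁻¹ - l₂ • (1 : Matrix (Fin 2) (Fin 2) ℂ)) i j‖ ^ 2 ≤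
        ∑ i : Fin 2, ∑ j : Fin 2, (2 * ‖(y * torusMatrix l₁ l₂ * y⁻¹) i j‖ ^ 2 + 2 * ‖(l₂ • (1 : Matrix (Fin 2) (Fin 2) ℂ)) i j‖ ^ 2) :=
      Finset.sum_le_sum fun i _ => Finset.sum_le_sum fun j _ => by
        rw [Matrix.sub_apply]
        exact hpq _ _
    have hone : ∑ i : Fin 2, ∑ j : Fin 2, ‖(l₂ • (1 : Matrix (Fin 2) (Fin 2) ℂ)) i j‖ ^ 2 = 2 * ‖l₂‖ ^ 2 := by
      simp [Fin.sum_univ_two, Matrix.one_apply]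
      ring
    have hsplit : ∑ i : Fin 2, ∑ j : Fin 2, (2 * ‖(y * torusMatrix l₁ l₂ * y⁻¹) i j‖ ^ 2 + 2 * ‖(l₂ • (1 : Matrix (Fin 2) (Fin 2) ℂ)) i j‖ ^ 2) =
        2 * ∑ i : Fin 2, ∑ j : Fin 2, ‖(y * torusMatrix l₁ l₂ * y⁻¹) i j‖ ^ 2 + 2 * ∑ i : Fin 2, ∑ j : Fin 2, ‖(l₂ • (1 : Matrix (Fin 2) (Fin 2) ℂ)) i j‖ ^ 2 := by
      simp only [Finset.sum_add_distrib, Finset.mul_sum]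
    rw [hsplit, hone] at hsum
    linarith
  rw [hs_conj_torusMatrix_sub_smul_one hy] at hM
  -- `(|λ₁-λ₂|/2)² S² ≤ 2R + 4|λ₂|²` ⇒ `S ≤ 2 √(2R + 4|λ₂|²) / |λ₁-λ₂|`
  have hK0 : 0 ≤ 2 * R + 4 * ‖l₂‖ ^ 2 := le_trans (by positivity) hM
  have hsq : (‖l₁ - l₂‖ / 2 * S) ^ 2 ≤ 2 * R + 4 * ‖l₂‖ ^ 2 := by rw [mul_pow]; exact hM
  have hle : ‖l₁ - l₂‖ / 2 * S ≤ Real.sqrt (2 * R + 4 * ‖l₂‖ ^ 2) :=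
    (Real.le_sqrt (mul_nonneg (div_nonneg (norm_nonneg (l₁ - l₂)) zero_le_two) hS0) hK0).mpr hsq
  rw [le_div_iff₀ hl]
  nlinarith [hle, Real.sqrt_nonneg (2 * R + 4 * ‖l₂‖ ^ 2)]

end EllipticOrbit

end Literature.NumberTheory.Rogawski1990

end
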